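import Summits.BirchSwinnertonDyer.Rank1Residual.Supersingular.SignedLambdaParityTwoMazurTate

/-!
# RankZeroSharpFlatLinkAN50 (= Sketch38; -an g34, MEMO-an §38 (R14)) — typed candidate `RankZeroSharpFlatLinkAtTwo` over TREE declarations

The trivial-character link between Sprung's two 2-adic `L`-functions of an elliptic curve with good
supersingular reduction at `2` (`a₂ ∈ {0, ±2}`): in the tree's normalisation (`IsSprungPair`: `θ_0 ≡ −L♭ (mod T)`,
`θ_1 ≡ −L♯ (mod ω_1)`) one has `L♯(0) = −aug θ_1 = −([1/8]⁺ + [3/8]⁺)`, `L♭(0) = −aug θ_0 = −[1/4]⁺`, and the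
distribution relations of modular symbols give `2[1/4]⁺ = (a₂² − 2a₂ − 1)·ℓ`, `2([1/8]⁺+[3/8]⁺) = (a₂³ − 2a₂² − 3a₂ + 4)·ℓ`
(`ℓ = [0]⁺ = L(E,1)/Ω⁺`), i.e. `L♯(0) = c(a₂)·L♭(0)` with `c(2) = 2`, `c(−2) = −6/7`, `c(0) = −4`:
`v₂(L♯(0)) = v₂(L♭(0)) + 1 + [a₂ = 0]`.  Consequences (with the Newton polygon, the `ι`-symmetry of the
root multiset — fixed points `T ∈ {0, −2}` — and the tree's PARITY(2) law `even_lam_sharp_two_iff`):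
(i) `λ(L♯₂) ≥ 1` ALWAYS; (ii) `r_an = 0`, `a₂ = ±2`: `λ(L♯₂) = 1 ↔ λ(L♭₂) = 0`; (iii) `r_an = 0`, `a₂ = 0`: `λ(L♯₂) ≥ 2`.
CENSUS (MTF2-PRED-v1.tsv, dimc16, sha16 a846fb242bf6a226; 2911 level-stable `μ`-normalised rows, N ≤ 499 985):
(i) 2911/2911 (`λ♯ = 0` never); (ii) rank-0 `a₂ = ±2` rows: `λ♯ = 1` on 154, `λ♭ = 0` on 154, the SAME 154 rows
(all with `N ≡ ±3 (8)`); (iii) 593/593 rank-0 `a₂ = 0` rows have `λ♯ ≥ 2` (min 2 at `N ≡ ±1 (8)`: 176 rows; min 3 at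
`N ≡ ±3 (8)`: 417 rows, where `λ♯ = 1` would be the parity-allowed value and NEVER occurs).
-/

namespace Summit.BirchSwinnertonDyer.Rank1Residual.Supersingular.Sketch38

open CongruenceSubgroup WeierstrassCurve Literature.NumberTheory.EllipticCurves
open Literature.NumberTheory.EllipticCurves.ModularForms Literature.NumberTheory.EllipticCurves.Sprung2017
open Summit.BirchSwinnertonDyer.Rank1Residual.X1.MuLambda Literature.NumberTheory.EllipticCurves.Rank1Residual
open scoped MatrixGroups ModularForm

/-- **TYPED CANDIDATE (P-an-38λ0) `RankZeroSharpFlatLinkAtTwo`.** -/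
def RankZeroSharpFlatLinkAtTwo : Prop :=
  ∀ (N : ℕ) [NeZero N] (f : CuspForm (Gamma0 N) 2) (W : WeierstrassCurve ℚ) [W.IsElliptic] [W.IsGloballyMinimal],
    IsNewformOf W f → W.HasGoodReductionAtPrime 2 → (2 : ℤ) ∣ W.frobeniusTrace 2 →
  ∀ (Lsharp Lflat : IwasawaAlgebra 2), IsSprungPair f 2 (W.frobeniusTrace 2) Lsharp Lflat →
    Lsharp ≠ 0 → Lflat ≠ 0 → mu Lsharp = 0 → mu Lflat = 0 →
    1 ≤ lam Lsharp ∧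
    (W.analyticRank = 0 → W.frobeniusTrace 2 ≠ 0 → (lam Lsharp = 1 ↔ lam Lflat = 0)) ∧
    (W.analyticRank = 0 → W.frobeniusTrace 2 = 0 → 2 ≤ lam Lsharp)

end Summit.BirchSwinnertonDyer.Rank1Residual.Supersingular.Sketch38
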